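import Summits.NavierStokesRegularity.FluidComputer.TriggerClassSweepLedger2

/-!
# Door N1-FC, the (host × Reynolds × seed-class) trigger sweep — ledger continuation of `TriggerClassSweepLedger` / `…Ledger2` (§9): the
# circuit seats' 384³ SECOND-ENGINE rows of the four WORDED symmetry-class cells on h_Σ(a), h_Σ(b) at ν₀/3, three integrators side by
# side, beside the pen's cell words «C-0» = KILL (cited)

Cell `pub-fluidc` (FLUID COMPUTER; host summit `NavierStokesRegularity`, negation side, machine paradigm), seat
`pub-fluidc-dns-B3` (ENGINE B, r = 3; gen 2, 2026-08-27; D-0081 §A2 «FLUID-COMPUTER TRIGGER SWEEP», bears_on N1-FC, token FC-TRIG-3).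
HONEST FRAMING: low prior, high value-of-information experiment on Tao's machine paradigm; NOT a claim that NS blows up.
WHAT THIS IS NOT: not Navier–Stokes evidence and not a word — TYPED ARITHMETIC on the numbers PRINTED by the cell's registered THIRD integrator at
the DECIDING GRID 384³ (PREREG-FC-TRIG-3 `code/gadgets/PREREG-FC-TRIG-3.md`, frozen prefix 77 177 B sha256 f46874a3…; §3.4 / RULING (B-1) l.101 / l.104,
(B-1.2): a clean-«C-0» r = 3 cell takes its 384³ second-engine X leg from the circuit seats — `ns-blowup-circuit3` on h_Σ(a) (C-0 PROJECTED j262083; #2 (aΣ, 3, mirror) T_e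
j265828; #3 (aΣ, 3, odd) T_o j268568) and `ns-blowup-circuit2` on h_Σ(b) (C-0 PROJECTED j266210; (bΣ, 3, mirror) [chain label «#5», CELLS.md row 8; the triple governs, prereg l.144] S_e j267242; (bΣ, 3, odd) [chain label «#6», CELLS.md row 9; the triple governs, prereg l.147] T_o j267278), code-disjoint pseudo-spectral
RK4 `main_c3.py` d72de2ee… / `main_c2.py` lineage — and its 256³ pair member from this seat, `TriggerClassSweepLedger2` §8 `b`). Sources = the custody pen's
MERGED RECORDS OF RECORD `code/gadgets/staging/fc-trig-3/reads/`: `records_a_r3_mirror_of_record.json` 7694bec4542a202f… (11 rows), `records_a_r3_odd_of_record.json` 4769cf113a21c35e…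
(9 rows), `records_b_r3_mirror_of_record.json` 1a4ad0ae35ff2bd5… (10 rows), `records_b_r3_odd_of_record.json` ce35aa423f29b063… (7 rows) — each merge K-READ row by
row against its sources and the reader `fc3_words.py` v3 re-run byte-identically by `pub-fluidc-ref4` / `ns-blowup-refuter2` before the word; the literals below
are those files' 7-decimal roundings. THE WORDS ARE THE PEN'S (prereg §6.1; cited, never claimed): l.139 SLOT 5 (ix) = cell #2 (aΣ, 3, mirror), l.145 SLOT 5 (xiii) = cell #3 (aΣ, 3, odd),
l.144 SLOT 5 (xii) = cell (bΣ, 3, mirror) [chain label «#5», CELLS.md row 8; the triple governs, prereg l.144], l.147 SLOT 5 (xiv) = cell (bΣ, 3, odd) [chain label «#6», CELLS.md row 9; the triple governs, prereg l.147] — verbatim: «CELL BELOW, rescue ABSENT both seeds — «C-0» = KILL» · «CELL BELOW, rescue ABSENT both seeds — «C-0» = KILL» · «CELL BELOW, rescue ABSENT both seeds — «C-0» = KILL» · «CELL BELOW, rescue ABSENT both seeds — «C-0» = KILL» («NO APPROXIMATE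
REFLECTION» printed with each, `TriggerClassSweepLedger.no_approximate_reflection`).

This file CONTINUES `TriggerClassSweepLedger` (§1–§7, dns-A5: the 22 engine-A rows) and `TriggerClassSweepLedger2` (§8 `b`, dns-A5 g2: the four engine-B 256³
members `etaChildB …`, `hostC0b` incl. circuit3's h_Σ(a) C-0 rows); identifiers of this block carry the suffix `c`. Companion: `TriggerClassSweepLedgerCDc` / `…CDd`
(the (c)/(d)/(b, generic) cells, same recipe; builders `gen_ab.py` / `check` inside it, beside the seat's notes).

* §9 (`c`): FOUR circuit 384³ X rows — (aΣ, 3, mirror) T_e ↔ engine-A row 3, (aΣ, 3, odd) T_o ↔ row 11, (bΣ, 3, mirror) S_e ↔ row 16, (bΣ, 3, odd) T_o ↔ row 21 — + `hostC0c` (h_Σ(a), h_Σ(b) at 384³ on the circuit):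
  `threeEngine_agree_c` (|η_child,C − η_child,A| ≤ 0.0000011 at 384³), `jump_eq_c`, `absent_above_delta_c` (10 |Λ_C| < δ_C; |Λ_C| ≤ 0.0005878), `sameClass_c`
  (|Λ_C − Λ_A| ≤ 0.0000010), `etaMinusC_le`, `hostC0c_vs_engineA`, `secondEngine_reads_bestCell_c` ((B-1.2) as arithmetic: the pen-named seed re-read by the circuit at the
  deciding grid = `bestCell` to ≤ 0.0000011), per cell `cell2_` / `cell3_` / `cellB3mirror_` / `cellB3odd_threeEngines` (engine A 256³ · engine B 256³ · engine A 384³ · circuit 384³ on the named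
  seed), floor-lemma instances on the circuit rows.
0 sorry; no named fact; no instance; axioms ⊆ {propext, Classical.choice, Quot.sound}.
-/

noncomputable section

namespace Summit.NavierStokesRegularity.FluidComputer.TriggerClassSweepLedger

open Summit.NavierStokesRegularity.FluidComputer.GadgetDetectionFloor
open Summit.NavierStokesRegularity.FluidComputer.TriggeredTransfer

/-! ## §9 APPEND `c` (dns-B3 gen 2, 2026-08-27): the circuit 384³ second-engine rows of the worded (aΣ / bΣ, 3, mirror / odd) cells

Member order (cell; arm; circuit job ↔ engine-A 384³ row / engine-A 256³ row / engine-B 256³ member of §8; peak row): 0: #2 (aΣ, 3, mirror) (aΣ, 3, mirror) T_e circuit3 j265828 ↔ 3 / 0 / 0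
(first-row, t_read 2.0000); 1: #3 (aΣ, 3, odd) (aΣ, 3, odd) T_o circuit3 j268568 ↔ 11 / 9 / 1 (first-row, 2.0000); 2: (bΣ, 3, mirror) [chain label «#5», CELLS.md row 8; the triple governs, prereg l.144] (bΣ, 3, mirror) S_e circuit2 j267242 ↔ 16 / 13 / 3
(interior, 2.0942); 3: (bΣ, 3, odd) [chain label «#6», CELLS.md row 9; the triple governs, prereg l.147] (bΣ, 3, odd) T_o circuit2 j267278 ↔ 21 / 19 / 2 (interior, 2.0500). t_inj 2.00, ε = 0.1, τ 0; MIRROR legs and Σ-host C-0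
continuations PROJECTED, ODD legs FREE. Each leg's C-0 = the circuit's OWN 384³ continuation of h_Σ from engine A's t 2.00 bytes (`hostC0c`). -/

/-- `η_child` on the circuit (384³) per member (7-decimal roundings of the pen's merged records of record). -/
def etaChildC : Fin 4 → ℝ := ![0.3287165, 0.3256043, 0.3320688, 0.3331167]
/-- `J` on the circuit per member (parity-exact `J = ε²` on the odd members 1, 3). -/
def jumpC : Fin 4 → ℝ := ![0.0131122, 0.0100000, 0.0083294, 0.0100000]
/-- The circuit's own `η_{C-0}` over the member's window at 384³ (h_Σ(a) j262083: the t 2.00 row; h_Σ(b) j266210). -/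
def etaHostC : Fin 4 → ℝ := ![0.3156043, 0.3156043, 0.3231516, 0.3231516]
/-- The circuit's floor `δ = max(0.02 η_child, |J − ε²|)` per member (relative branch on all four). -/
def deltaC : Fin 4 → ℝ := ![0.0065743, 0.0065121, 0.0066414, 0.0066623]
/-- `η⁻ = η_child − J` on the circuit. -/
def etaMinusC (k : Fin 4) : ℝ := etaChildC k - jumpC k
/-- `Λ` on the circuit (its own C-0 row). -/
def lambdaMechC (k : Fin 4) : ℝ := (etaChildC k - etaHostC k) - jumpC k
/-- Engine-A 384³ row matched by each member. -/
def rowOfC : Fin 4 → Fin 22 := ![3, 11, 16, 21]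
/-- Engine-A 256³ row of the same seed. -/
def row256OfC : Fin 4 → Fin 22 := ![0, 9, 13, 19]
/-- Engine-B 256³ member of §8 (`etaChildB` …) of the same seed. -/
def memberBOfC : Fin 4 → Fin 4 := ![0, 1, 3, 2]

/-- THREE-ENGINE AGREEMENT at the deciding grid on h_Σ(a), h_Σ(b): `|η_child,C − η_child,A| ≤ 0.0000011` (≤ 1e-5 · η) on all four members — a fortiori the registered 5 %
(whose verdict is the pen's). [folklore] -/
theorem threeEngine_agree_c : ∀ k : Fin 4, |etaChildC k - etaChild (rowOfC k)| ≤ 0.0000011 ∧ |etaChildC k - etaChild (rowOfC k)| ≤ 1e-5 * etaChild (rowOfC k) ∧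
    |etaChildC k - etaChild (rowOfC k)| ≤ 0.05 * etaChild (rowOfC k) := by
  intro k; fin_cases k <;> simp [etaChildC, etaChild, rowOfC] <;> norm_num [abs_le]

/-- Same seed bytes ⇒ `J` and `δ` are engine A's 7-decimal numbers (δ to 1e-7, relative branch). [folklore] -/
theorem jump_eq_c : ∀ k : Fin 4, jumpC k = jump (rowOfC k) ∧ |deltaC k - delta (rowOfC k)| ≤ 1e-7 ∧ |deltaC k - 0.02 * etaChildC k| ≤ 1e-7 ∧
    ((k = 1 ∨ k = 3) → jumpC k = 0.01) := by
  intro k; fin_cases k <;> simp [jumpC, jump, deltaC, delta, etaChildC, rowOfC] <;> norm_num [abs_le]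

/-- «mech ≤ δ» on the third integrator, h_Σ(a), h_Σ(b): `10 |Λ_C| < δ_C` on all four members (the one increment above 1e-4 is (bΣ, 3, mirror) S_e — the same `+5.9e-4`
engine A printed on row 16 and engine B on §8 member 3, «11× inside»); `|Λ_C| ≤ 0.0005878`; `Λ_C = 0` EXACTLY on member(s) 0, 1. [folklore] -/
theorem absent_above_delta_c : ∀ k : Fin 4, |lambdaMechC k| ≤ deltaC k ∧ 10 * |lambdaMechC k| < deltaC k ∧ |lambdaMechC k| ≤ 0.0005878 ∧ (k = 0 → lambdaMechC k = 0) ∧ (k = 1 → lambdaMechC k = 0) := by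
  intro k; fin_cases k <;> simp [lambdaMechC, etaChildC, etaHostC, jumpC, deltaC] <;> norm_num [abs_le, abs_lt]

/-- SAME CLASS on engine A and the circuit at 384³: `|Λ_C − Λ_A| ≤ 0.0000010` on all four; each `Λ` inside BOTH floors. [folklore] -/
theorem sameClass_c : ∀ k : Fin 4, |lambdaMechC k - lambdaMech (rowOfC k)| ≤ 0.0000010 ∧ |lambdaMech (rowOfC k)| ≤ deltaC k ∧ |lambdaMechC k| ≤ delta (rowOfC k) := by
  intro k; fin_cases k <;> simp [lambdaMechC, lambdaMech, etaChildC, etaHostC, jumpC, deltaC, etaChild, etaHost, jump, delta, rowOfC] <;> norm_num [abs_le]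

/-- The circuit's `η⁻`: within `0.0000011` of engine A's 384³ row; `≤ 0.3302` (the Σ-host gap lemma's ceiling, `hostSigma_gap`), hence `≤ 349/1000`, gap `≥ 0.165`. [folklore] -/
theorem etaMinusC_le : ∀ k : Fin 4, |etaMinusC k - etaMinus (rowOfC k)| ≤ 0.0000011 ∧ etaMinusC k ≤ 0.3302 ∧ etaMinusC k ≤ 349 / 1000 ∧ 0.165 ≤ 1 / 2 - etaMinusC k := by
  intro k; fin_cases k <;> simp [etaMinusC, etaMinus, etaChildC, jumpC, etaChild, jump, rowOfC] <;> norm_num [abs_le]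

/-- Every circuit floor `δ ≤ 7/1000`. [folklore] -/
theorem deltaC_le : ∀ k : Fin 4, deltaC k ≤ 7 / 1000 := by
  intro k; fin_cases k <;> simp [deltaC] <;> norm_num

/-- MEMBER BY MEMBER on the third integrator (`not_kelvin_two_of_reading`). [folklore] -/
theorem no_kelvin_two_of_rowC (k : Fin 4) {η : ℝ} (hread : |etaMinusC k - η| ≤ deltaC k) : ¬ 1 < η * 2 :=
  not_kelvin_two_of_reading hread (etaMinusC_le k).2.2.1 ((deltaC_le k).trans (by norm_num))

/-- … and no one-child `TriggerScheme` with `λ = 2` inside the circuit's certified window of any member. [cite: Tao2016AveragedNS, §1.3] -/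
theorem no_triggerScheme_two_of_rowC (k : Fin 4) :
    ¬ ∃ 𝒮 : TriggerScheme, 𝒮.lam = 2 ∧ |etaMinusC k - 𝒮.eta| ≤ deltaC k :=
  not_exists_triggerScheme_two_of_reading (etaMinusC_le k).2.2.1 ((deltaC_le k).trans (by norm_num))

/-- Resolution certificate `k_max·η_K` on the circuit at 384³ per member = the child's own minimum over `[t_inj, t_read]` (3 decimals). -/
def certMinC : Fin 4 → ℝ := ![2.050, 2.051, 2.032, 2.033]

/-- THE REGISTERED FINE STANDARD HOLDS on every member (`k_max·η_K ≥ 1.3`, indeed `≥ 2.0`). [folklore] -/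
theorem certificate_standard_c : ∀ k : Fin 4, 1.3 ≤ certMinC k ∧ 2.0 ≤ certMinC k := by
  intro k; fin_cases k <;> simp [certMinC] <;> norm_num

/-- The circuit's untriggered 384³ window values: h_Σ(a) circuit3 j262083 (the t 2.00 row; = `hostC0b 2` of §8), h_Σ(b) circuit2 j266210 (interior). -/
def hostC0c : Fin 2 → ℝ := ![0.3156043, 0.3231516]

/-- The members' C-0 rows ARE these two runs. [folklore] -/
theorem etaHostC_eq_hostC0c : etaHostC 0 = hostC0c 0 ∧ etaHostC 1 = hostC0c 0 ∧ etaHostC 2 = hostC0c 1 ∧ etaHostC 3 = hostC0c 1 := by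
  simp [etaHostC, hostC0c]

/-- THREE INTEGRATORS, ONE HOST at the deciding grid: on h_Σ(a) the circuit's t 2.00 row IS engine A's `etaHost 3` (= `hostC0b 2`, `host_threeEngine_b`) EXACTLY; on h_Σ(b)
the window CONTAINS the variant's peak (t_pk 2.055 > t_inj), so the circuit's window maximum sits within `0.0000011` of engine A's `etaHost 16 = hostSigmaMax 3` (the 384³
maximum of record); on h_Σ(a) (peak 1.93 < t_inj) the window value lies below the earlier peak `hostSigmaMax 1`. [folklore] -/
theorem hostC0c_vs_engineA : (hostC0c 0 = etaHost 3 ∧ hostC0c 0 = hostC0b 2 ∧ hostC0c 0 < hostSigmaMax 1) ∧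
    (|hostC0c 1 - etaHost 16| ≤ 0.0000011 ∧ etaHost 16 = hostSigmaMax 3 ∧ |hostC0c 1 - hostSigmaMax 3| ≤ 0.0000011) := by
  refine ⟨?_, ?_⟩
  · simp [hostC0c, etaHost, hostC0b, hostSigmaMax]; norm_num
  · simp [hostC0c, etaHost, hostSigmaMax]; norm_num [abs_le]

/-- Every circuit host window value is `< 1/2` with gap `≥ 0.1768`. [folklore] -/
theorem hostC0c_gap : ∀ i : Fin 2, hostC0c i < 1 / 2 ∧ 0.1768 ≤ 1 / 2 - hostC0c i := by
  intro i; fin_cases i <;> simp [hostC0c] <;> norm_num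

/-- (B-1.2) AS ARITHMETIC: the pen-named seed re-read by the circuit at the deciding grid reproduces `bestCell 0 / 1 / 2 / 3` ((aΣ, mirror) / (aΣ, odd) / (bΣ, mirror) / (bΣ, odd)) to `≤ 0.0000011`. [folklore] -/
theorem secondEngine_reads_bestCell_c : ∀ k : Fin 4, |etaMinusC k - bestCell k| ≤ 0.0000011 := by
  intro k; fin_cases k <;> simp [etaMinusC, etaChildC, jumpC, bestCell] <;> norm_num [abs_le]

/-- CELL #2 (aΣ, 3, mirror), seed T_e — word of record prereg l.139 SLOT 5 (ix) «CELL BELOW, rescue ABSENT both seeds — «C-0» = KILL» (the pen's): `η⁻` reads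
0.3155877 (A 256³, row 0) · 0.3155877 (B 256³, §8 member 0) · 0.3156043 (A 384³, row 3) · 0.3156043 (circuit 384³) — spread `≤ 0.0000166` across grids, `≤ 0.0000001` between
integrators at equal grid; `Λ` = +4.75e-05 · +0.00e+00 · +0.00e+00 · +0.00e+00, every one below 1/20 of each of the four floors (min 0.0065740). [folklore] -/
theorem cell2_threeEngines :
    (|etaMinus 0 - etaMinusB 0| ≤ 0.0000001 ∧ |etaMinus 3 - etaMinusC 0| ≤ 0.0000001 ∧ |etaMinus 3 - etaMinus 0| ≤ 0.0000166 ∧ |etaMinusC 0 - etaMinusB 0| ≤ 0.0000166) ∧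
    (20 * |lambdaMech 0| < deltaC 0 ∧ 20 * |lambdaMechB 0| < deltaC 0 ∧ 20 * |lambdaMech 3| < deltaC 0 ∧ 20 * |lambdaMechC 0| < deltaC 0 ∧
      20 * |lambdaMech 0| < deltaB 0 ∧ 20 * |lambdaMechC 0| < deltaB 0 ∧ 20 * |lambdaMechC 0| < delta 0 ∧ 20 * |lambdaMechB 0| < delta 3) ∧
    (etaMinus 3 < 0.45 ∧ etaMinusC 0 < 0.45 ∧ 0.165 ≤ 1 / 2 - etaMinusC 0) := by
  refine ⟨?_, ?_, ?_⟩ <;>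
    simp [etaMinus, etaMinusB, etaMinusC, lambdaMech, lambdaMechB, lambdaMechC, etaChild, jump, etaHost, delta, etaChildB, jumpB, etaHostB, deltaB,
      etaChildC, jumpC, etaHostC, deltaC] <;> norm_num [abs_le, abs_lt]

/-- CELL #3 (aΣ, 3, odd), seed T_o — word of record prereg l.145 SLOT 5 (xiii) «CELL BELOW, rescue ABSENT both seeds — «C-0» = KILL» (the pen's): `η⁻` reads
0.3155877 (A 256³, row 9) · 0.3155877 (B 256³, §8 member 1) · 0.3156043 (A 384³, row 11) · 0.3156043 (circuit 384³) — spread `≤ 0.0000166` across grids, `≤ 0.0000001` between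
integrators at equal grid; `Λ` = +4.75e-05 · +0.00e+00 · +0.00e+00 · +0.00e+00, every one below 1/20 of each of the four floors (min 0.0065118). [folklore] -/
theorem cell3_threeEngines :
    (|etaMinus 9 - etaMinusB 1| ≤ 0.0000001 ∧ |etaMinus 11 - etaMinusC 1| ≤ 0.0000001 ∧ |etaMinus 11 - etaMinus 9| ≤ 0.0000166 ∧ |etaMinusC 1 - etaMinusB 1| ≤ 0.0000166) ∧
    (20 * |lambdaMech 9| < deltaC 1 ∧ 20 * |lambdaMechB 1| < deltaC 1 ∧ 20 * |lambdaMech 11| < deltaC 1 ∧ 20 * |lambdaMechC 1| < deltaC 1 ∧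
      20 * |lambdaMech 9| < deltaB 1 ∧ 20 * |lambdaMechC 1| < deltaB 1 ∧ 20 * |lambdaMechC 1| < delta 9 ∧ 20 * |lambdaMechB 1| < delta 11) ∧
    (etaMinus 11 < 0.45 ∧ etaMinusC 1 < 0.45 ∧ 0.165 ≤ 1 / 2 - etaMinusC 1) := by
  refine ⟨?_, ?_, ?_⟩ <;>
    simp [etaMinus, etaMinusB, etaMinusC, lambdaMech, lambdaMechB, lambdaMechC, etaChild, jump, etaHost, delta, etaChildB, jumpB, etaHostB, deltaB,
      etaChildC, jumpC, etaHostC, deltaC] <;> norm_num [abs_le, abs_lt]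

/-- CELL (bΣ, 3, mirror) [chain label «#5», CELLS.md row 8; the triple governs, prereg l.144], seed S_e — word of record prereg l.144 SLOT 5 (xii) «CELL BELOW, rescue ABSENT both seeds — «C-0» = KILL» (the pen's): `η⁻` reads
0.3236830 (A 256³, row 13) · 0.3236827 (B 256³, §8 member 3) · 0.3237383 (A 384³, row 16) · 0.3237394 (circuit 384³) — spread `≤ 0.0000567` across grids, `≤ 0.0000011` between
integrators at equal grid; `Λ` = +5.80e-04 · +5.81e-04 · +5.88e-04 · +5.88e-04, every one below 1/10 of each of the four floors (min 0.0066401). [folklore] -/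
theorem cellB3mirror_threeEngines :
    (|etaMinus 13 - etaMinusB 3| ≤ 0.0000011 ∧ |etaMinus 16 - etaMinusC 2| ≤ 0.0000011 ∧ |etaMinus 16 - etaMinus 13| ≤ 0.0000567 ∧ |etaMinusC 2 - etaMinusB 3| ≤ 0.0000567) ∧
    (10 * |lambdaMech 13| < deltaC 2 ∧ 10 * |lambdaMechB 3| < deltaC 2 ∧ 10 * |lambdaMech 16| < deltaC 2 ∧ 10 * |lambdaMechC 2| < deltaC 2 ∧
      10 * |lambdaMech 13| < deltaB 3 ∧ 10 * |lambdaMechC 2| < deltaB 3 ∧ 10 * |lambdaMechC 2| < delta 13 ∧ 10 * |lambdaMechB 3| < delta 16) ∧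
    (etaMinus 16 < 0.45 ∧ etaMinusC 2 < 0.45 ∧ 0.165 ≤ 1 / 2 - etaMinusC 2) := by
  refine ⟨?_, ?_, ?_⟩ <;>
    simp [etaMinus, etaMinusB, etaMinusC, lambdaMech, lambdaMechB, lambdaMechC, etaChild, jump, etaHost, delta, etaChildB, jumpB, etaHostB, deltaB,
      etaChildC, jumpC, etaHostC, deltaC] <;> norm_num [abs_le, abs_lt]

/-- CELL (bΣ, 3, odd) [chain label «#6», CELLS.md row 9; the triple governs, prereg l.147], seed T_o — word of record prereg l.147 SLOT 5 (xiv) «CELL BELOW, rescue ABSENT both seeds — «C-0» = KILL» (the pen's): `η⁻` reads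
0.3230660 (A 256³, row 19) · 0.3230681 (B 256³, §8 member 2) · 0.3231166 (A 384³, row 21) · 0.3231167 (circuit 384³) — spread `≤ 0.0000507` across grids, `≤ 0.0000021` between
integrators at equal grid; `Λ` = -3.65e-05 · -3.35e-05 · -3.39e-05 · -3.49e-05, every one below 1/20 of each of the four floors (min 0.0066613). [folklore] -/
theorem cellB3odd_threeEngines :
    (|etaMinus 19 - etaMinusB 2| ≤ 0.0000021 ∧ |etaMinus 21 - etaMinusC 3| ≤ 0.0000021 ∧ |etaMinus 21 - etaMinus 19| ≤ 0.0000507 ∧ |etaMinusC 3 - etaMinusB 2| ≤ 0.0000507) ∧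
    (20 * |lambdaMech 19| < deltaC 3 ∧ 20 * |lambdaMechB 2| < deltaC 3 ∧ 20 * |lambdaMech 21| < deltaC 3 ∧ 20 * |lambdaMechC 3| < deltaC 3 ∧
      20 * |lambdaMech 19| < deltaB 2 ∧ 20 * |lambdaMechC 3| < deltaB 2 ∧ 20 * |lambdaMechC 3| < delta 19 ∧ 20 * |lambdaMechB 2| < delta 21) ∧
    (etaMinus 21 < 0.45 ∧ etaMinusC 3 < 0.45 ∧ 0.165 ≤ 1 / 2 - etaMinusC 3) := by
  refine ⟨?_, ?_, ?_⟩ <;>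
    simp [etaMinus, etaMinusB, etaMinusC, lambdaMech, lambdaMechB, lambdaMechC, etaChild, jump, etaHost, delta, etaChildB, jumpB, etaHostB, deltaB,
      etaChildC, jumpC, etaHostC, deltaC] <;> norm_num [abs_le, abs_lt]

/-- THE FOUR (aΣ / bΣ) CELLS, THREE INTEGRATORS, TWO GRIDS — on every pen-named seed ((aΣ, mirror) T_e, (aΣ, odd) T_o, (bΣ, mirror) S_e, (bΣ, odd) T_o) the mechanical excess reads `|Λ| ≤ 0.0005878` on engine A at
256³ and 384³ (`TriggerClassSweepLedger` rows 0/3, 9/11, 13/16, 19/21), on engine B at 256³ (§8 members) and on the circuit at 384³ (§9 members): below 1/10 of `0.0064331`, the smallest floor typed in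
`TriggerClassSweepLedger` / `…2` / `…3` (the maximum is the (bΣ, 3, mirror) S_e increment, read alike by all three integrators). The words on these cells are the pen's (l.139 / l.145 /
l.144 / l.147); this is their arithmetic. [folklore] -/
theorem abCells_threeEngines_absent :
    (∀ i : Fin 8, |lambdaMech (![0, 3, 9, 11, 13, 16, 19, 21] i)| ≤ 0.0005878) ∧ (∀ k : Fin 4, |lambdaMechB k| ≤ 0.0005878) ∧ (∀ k : Fin 4, |lambdaMechC k| ≤ 0.0005878) ∧
    (10 * (0.0005878 : ℝ) < 0.0064331 ∧ (∀ i : Fin 22, 0.0064331 ≤ delta i) ∧ (∀ k : Fin 4, 0.0064331 ≤ deltaB k) ∧ ∀ k : Fin 4, 0.0064331 ≤ deltaC k) := by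
  refine ⟨fun i => ?_, fun k => ?_, fun k => ?_, ⟨by norm_num, fun i => ?_, fun k => ?_, fun k => ?_⟩⟩
  · fin_cases i <;> simp [lambdaMech, etaChild, etaHost, jump] <;> norm_num [abs_le]
  · fin_cases k <;> simp [lambdaMechB, etaChildB, etaHostB, jumpB] <;> norm_num [abs_le]
  · fin_cases k <;> simp [lambdaMechC, etaChildC, etaHostC, jumpC] <;> norm_num [abs_le]
  · fin_cases i <;> simp [delta] <;> norm_num
  · fin_cases k <;> simp [deltaB] <;> norm_num
  · fin_cases k <;> simp [deltaC] <;> norm_num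

end Summit.NavierStokesRegularity.FluidComputer.TriggerClassSweepLedger

end
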